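import Mathlib
import Literature.NumberTheory.LFunctions.Zhang2022.Section12Top1225ExFrontEnd
import HarnessLib

/-!
# Zhang (2022) §12 (12.13), exact reading: the exact window `𝓦ˣ_j` is `C¹` in `t` with
# `‖(𝓦ˣ_j)′(t)‖ ≪_{c′} α/t` on `[1, P]` (the profile input of the window-sum → integral step)

Topic `Literature/NumberTheory/LFunctions/Zhang2022` (Landau–Siegel audit tree; verdict-neutral).
Y. Zhang, *Discrete mean estimates and the Landau–Siegel zero*, arXiv:2211.02515v1 (2022)
[Zhang2022LandauSiegel] — **an unrefereed manuscript under adjudication; theorem-only file (calculus of an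
explicit function), nothing here bears on its Theorems 1–2** (lane ZHANG-L, WP12, seat zl-w12-p6; node
`Typed.Sec12C.Top1225Ex`, RT-02). Third layer of the top-range evaluation of `S_j(𝐚₁₂,𝐚₂₅)`: the exact
window `𝓦ˣ_j(t) = −[(t/P″₁)^{β₆}(1 − β_{j+1}β_{j+2}∫₁^{P″₂/t}y^{β₆−1}log y dy) − (t/P″₁)^{β₆}log(t/P″₁)
(−β₆ + β_{j+1} + β_{j+2} + β_{j+1}β_{j+2}∫₁^{P″₂/t}y^{β₆−1}dy)]` (`TypedSection12CExact.frakwEx`) — the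
weight "`𝓦_j`" of (12.13), p. 71 — is differentiable in `t > 0` (`hasDerivAt_frakwEx`: the two integrals
by the fundamental theorem of calculus at the moving endpoint `P″₂/t`, the power by the chain rule) and,
on `1 ≤ t ≤ P` with `𝓛 ≥ 3`, `‖(𝓦ˣ_j)′(t)‖ ≤ K_w(c′)·α/t`, `K_w = 3(1+5|c′|π)(4 + 6κ + 2κ²)`,
`κ = 3π(1+5|c′|π)` (`norm_deriv_frakwEx_le`; every `β` has norm `≤ 3α(1+5|c′|π)`, the logarithms are
`≤ 𝓛⁹`, `α𝓛⁹ = π`). This is the `M′ = O(α)` input of the §8 evaluation rule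
(`Section8RangeEngine.weighted_sum_integral_eval`) for the profile `𝔣_{jμ}(P_k/t)𝓦ˣ_j(t)`.

## References

* Y. Zhang, arXiv:2211.02515v1 (2022), §12 (12.13) p. 71, tex L3614–L3624; Lemma 12.3 proof p. 70.
  [cite: Zhang2022LandauSiegel, §12 (12.13) p. 71]
-/

noncomputable section

open Complex Real ComplexConjugate

namespace Literature.NumberTheory.LFunctions.Zhang2022.Typed.Sec12C

open Literature.NumberTheory.LFunctions.Zhang2022.Skeleton
open Literature.NumberTheory.LFunctions.Zhang2022.Typed.Sec10C.Ranges1422 (alpha_facts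
  log_le_of_le_bigP)

namespace Top1225

section Calculus

variable (c' : ℝ) {D : ℕ}

/-- FTC at a moving right endpoint: for `b, t > 0` and `f` continuous on `(0, ∞)`,
`d/dt ∫₁^{b/t} f = f(b/t)·(−b/t²)`. [cite: Zhang2022LandauSiegel, §12 Lemma 12.3 proof p. 70, tex L3581] -/
theorem hasDerivAt_integral_comp_div {f : ℝ → ℂ} (hf : ContinuousOn f (Set.Ioi 0)) {b t : ℝ}
    (hb : 0 < b) (ht : 0 < t) :
    HasDerivAt (fun u : ℝ => ∫ y in (1:ℝ)..(b / u), f y) ((-(b / t ^ 2)) • f (b / t)) t := by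
  have hbt : 0 < b / t := div_pos hb ht
  have hΦ : HasDerivAt (fun u : ℝ => ∫ y in (1:ℝ)..u, f y) (f (b / t)) (b / t) := by
    refine intervalIntegral.integral_hasDerivAt_right ?_ ?_ ?_
    · refine (hf.mono ?_).intervalIntegrable
      intro y hy
      rcases le_total 1 (b / t) with h | h
      · rw [Set.uIcc_of_le h] at hy; exact lt_of_lt_of_le one_pos hy.1
      · rw [Set.uIcc_of_ge h] at hy; exact lt_of_lt_of_le hbt hy.1
    · exact hf.stronglyMeasurableAtFilter isOpen_Ioi _ hbt
    · exact hf.continuousAt (Ioi_mem_nhds hbt)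
  have hu : HasDerivAt (fun u : ℝ => b / u) (-(b / t ^ 2)) t := by
    have h := (hasDerivAt_inv ht.ne').const_mul b
    refine (h.congr_of_eventuallyEq ?_).congr_deriv (by ring)
    exact Filter.Eventually.of_forall fun u => by simp [div_eq_mul_inv]
  exact hΦ.scomp t hu

/-- **The exact window is differentiable in `t > 0`**, with the derivative given by the product rule
and the fundamental theorem of calculus at the moving endpoint `P″₂/t` (`𝓛 ≥ 1`).
[cite: Zhang2022LandauSiegel, §12 (12.13) p. 71, tex L3624] -/
theorem hasDerivAt_frakwEx (hD : 1 ≤ Real.log D) (j : ℕ) {t : ℝ} (ht : 0 < t) :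
    HasDerivAt (fun y : ℝ => frakwEx c' D j y)
      (-((beta6 D * (((t / P1pp D : ℝ) : ℂ)) ^ (beta6 D - 1) * ((1 / P1pp D : ℝ) : ℂ)) *
            (1 - betaJ c' D (j + 1) * betaJ c' D (j + 2) *
              ∫ y in (1:ℝ)..(P2pp D / t), (y : ℂ) ^ (beta6 D - 1) * (Real.log y : ℂ)) +
          (((t / P1pp D : ℝ) : ℂ)) ^ beta6 D *
            (-(betaJ c' D (j + 1) * betaJ c' D (j + 2) *
              ((-(P2pp D / t ^ 2) : ℝ) • ((((P2pp D / t : ℝ) : ℂ)) ^ (beta6 D - 1) *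
                (Real.log (P2pp D / t) : ℂ))))) -
          ((beta6 D * (((t / P1pp D : ℝ) : ℂ)) ^ (beta6 D - 1) * ((1 / P1pp D : ℝ) : ℂ)) *
              (Real.log (t / P1pp D) : ℂ) *
              (-beta6 D + betaJ c' D (j + 1) + betaJ c' D (j + 2) +
                betaJ c' D (j + 1) * betaJ c' D (j + 2) *
                  ∫ y in (1:ℝ)..(P2pp D / t), (y : ℂ) ^ (beta6 D - 1)) +
            (((t / P1pp D : ℝ) : ℂ)) ^ beta6 D * (((1 / t : ℝ) : ℂ)) *
              (-beta6 D + betaJ c' D (j + 1) + betaJ c' D (j + 2) +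
                betaJ c' D (j + 1) * betaJ c' D (j + 2) *
                  ∫ y in (1:ℝ)..(P2pp D / t), (y : ℂ) ^ (beta6 D - 1)) +
            (((t / P1pp D : ℝ) : ℂ)) ^ beta6 D * (Real.log (t / P1pp D) : ℂ) *
              (betaJ c' D (j + 1) * betaJ c' D (j + 2) *
                ((-(P2pp D / t ^ 2) : ℝ) • (((P2pp D / t : ℝ) : ℂ)) ^ (beta6 D - 1)))))) t := by
  have ha : 0 < P1pp D := Sec12D.P1pp_pos hD
  have hb : 0 < P2pp D := Sec12D.P2pp_pos hD
  set β := beta6 D with hβ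
  set γ := betaJ c' D (j + 1) * betaJ c' D (j + 2) with hγ
  set η := -beta6 D + betaJ c' D (j + 1) + betaJ c' D (j + 2) with hη
  -- U(t) = (t/P″₁)^β
  have hU : HasDerivAt (fun y : ℝ => (((y / P1pp D : ℝ) : ℂ)) ^ β)
      (β * (((t / P1pp D : ℝ) : ℂ)) ^ (β - 1) * ((1 / P1pp D : ℝ) : ℂ)) t := by
    have h1 : HasDerivAt (fun z : ℂ => (z / (P1pp D : ℂ)) ^ β)
        (β * ((t : ℂ) / (P1pp D : ℂ)) ^ (β - 1) * (1 / (P1pp D : ℂ))) (t : ℂ) := by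
      have hid : HasDerivAt (fun z : ℂ => z / (P1pp D : ℂ)) (1 / (P1pp D : ℂ)) (t : ℂ) := by
        simpa using (hasDerivAt_id (t : ℂ)).div_const (P1pp D : ℂ)
      refine hid.cpow_const ?_
      rw [Complex.mem_slitPlane_iff]
      left
      have : ((t : ℂ) / (P1pp D : ℂ)).re = t / P1pp D := by
        rw [← Complex.ofReal_div]; exact Complex.ofReal_re _
      rw [this]; exact div_pos ht ha
    have h2 := h1.comp_ofReal
    have e1 : (fun y : ℝ => ((y : ℂ) / (P1pp D : ℂ)) ^ β) = fun y : ℝ => (((y / P1pp D : ℝ) : ℂ)) ^ β := by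
      funext y; rw [Complex.ofReal_div]
    rw [e1] at h2
    refine h2.congr_deriv ?_
    rw [← Complex.ofReal_div, ← Complex.ofReal_one, ← Complex.ofReal_div]
  -- Λ(t) = log(t/P″₁)
  have hΛ : HasDerivAt (fun y : ℝ => ((Real.log (y / P1pp D) : ℝ) : ℂ)) (((1 / t : ℝ) : ℂ)) t := by
    have h1 : HasDerivAt (fun y : ℝ => y / P1pp D) (1 / P1pp D) t := by
      simpa using (hasDerivAt_id t).div_const (P1pp D)
    have h2 := HasDerivAt.comp t (Real.hasDerivAt_log (div_pos ht ha).ne') h1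
    have h3 := h2.ofReal_comp
    refine h3.congr_deriv ?_
    congr 1
    field_simp
  -- the two integrals
  have hf1 : ContinuousOn (fun y : ℝ => (y : ℂ) ^ (β - 1)) (Set.Ioi 0) := fun y hy =>
    (Complex.continuousAt_ofReal_cpow_const y (β - 1) (Or.inr (ne_of_gt hy))).continuousWithinAt
  have hf2 : ContinuousOn (fun y : ℝ => (y : ℂ) ^ (β - 1) * (Real.log y : ℂ)) (Set.Ioi 0) :=
    fun y hy => ((Complex.continuousAt_ofReal_cpow_const y (β - 1) (Or.inr (ne_of_gt hy))).mul
      (Complex.continuous_ofReal.continuousAt.comp (Real.continuousAt_log (ne_of_gt hy)))).continuousWithinAt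
  have hI1 := hasDerivAt_integral_comp_div hf1 hb ht
  have hI2 := hasDerivAt_integral_comp_div hf2 hb ht
  -- assemble
  have hA := hU.mul ((hI2.const_mul γ).const_sub 1)
  have hB := ((hU.mul hΛ).mul ((hI1.const_mul γ).const_add η))
  have h := (hA.sub hB).neg
  refine (h.congr_of_eventuallyEq ?_).congr_deriv ?_
  · exact Filter.Eventually.of_forall fun y => rfl
  · simp only [hγ, hη, hβ, Pi.mul_apply]
    ring

/-- **Size of the derivative of the exact window**: for `𝓛 ≥ 3` and `1 ≤ t ≤ P`,
`‖(𝓦ˣ_j)′(t)‖ ≤ K_w·α/t`, `K_w = 3(1+5|c′|π)(4 + 6κ + 2κ²)`, `κ = 3π(1+5|c′|π)`.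
[cite: Zhang2022LandauSiegel, §12 (12.13) p. 71, tex L3624] -/
theorem norm_deriv_frakwEx_le (hℓ : 3 ≤ ell D) (j : ℕ) {t : ℝ} (ht1 : 1 ≤ t) (htP : t ≤ bigP D) :
    DifferentiableAt ℝ (fun y : ℝ => frakwEx c' D j y) t ∧
      ‖deriv (fun y : ℝ => frakwEx c' D j y) t‖ ≤
        3 * (1 + 5 * |c'| * π) * (4 + 6 * (3 * π * (1 + 5 * |c'| * π)) +
          2 * (3 * π * (1 + 5 * |c'| * π)) ^ 2) * alpha D / t := by
  have h1 : 1 ≤ ell D := by linarith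
  have h0 : 0 < ell D := by linarith
  have hlog1 : 1 ≤ Real.log D := h1
  have ht : 0 < t := by linarith
  have ha := Sec12D.P1pp_pos hlog1 (D := D)
  have hb := Sec12D.P2pp_pos hlog1 (D := D)
  have hd := hasDerivAt_frakwEx c' hlog1 j ht
  refine ⟨hd.differentiableAt, ?_⟩
  rw [hd.deriv]
  -- sizes
  obtain ⟨hlP1lo, hlP1hi, hlP2lo, hlP2hi⟩ := log_P1pp_P2pp_bounds (D := D) hℓ
  have hpoly : 520 * ell D ≤ 0.5 * ell D ^ 9 := by
    have h8 : (3 : ℝ) ^ 8 ≤ ell D ^ 8 := pow_le_pow_left₀ (by norm_num) hℓ 8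
    nlinarith
  have hlogt : 0 ≤ Real.log t ∧ Real.log t ≤ ell D ^ 9 := log_le_of_le_bigP ht1 htP
  set Λ : ℝ := ell D ^ 9 with hΛ
  have hL1 : |Real.log (t / P1pp D)| ≤ Λ := by
    rw [Real.log_div ht.ne' ha.ne', abs_le]; constructor <;> linarith [hlogt.1, hlogt.2]
  set X : ℝ := P2pp D / t with hX
  have hX0 : 0 < X := div_pos hb ht
  have hL2 : |Real.log X| ≤ Λ := by
    rw [hX, Real.log_div hb.ne' ht.ne', abs_le]; constructor <;> linarith [hlogt.1, hlogt.2]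
  set b : ℝ := 3 * alpha D * (1 + 5 * |c'| * π) with hbdef
  have hα := Sec12D.alpha_pos_of_log hlog1 (D := D)
  have hb0 : 0 ≤ b := by rw [hbdef]; positivity
  have hβ1 : ‖betaJ c' D (j + 1)‖ ≤ b := Sec12D.norm_betaJ_le c' hlog1 _
  have hβ2 : ‖betaJ c' D (j + 2)‖ ≤ b := Sec12D.norm_betaJ_le c' hlog1 _
  have hβ6 : ‖beta6 D‖ ≤ b := by
    rw [(Sec12D.norm_beta67 hlog1 (D := D)).1, hbdef]
    have : 0 ≤ alpha D * (5 * |c'| * π) := by positivity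
    nlinarith
  have hβ6re : (beta6 D).re = 0 := by simp [beta6]
  set κ : ℝ := 3 * π * (1 + 5 * |c'| * π) with hκ
  have hbΛ : b * Λ = κ := by
    rw [hbdef, hΛ, hκ]
    have := (alpha_facts (D := D) hℓ).2.2
    calc 3 * alpha D * (1 + 5 * |c'| * π) * ell D ^ 9
        = 3 * (alpha D * ell D ^ 9) * (1 + 5 * |c'| * π) := by ring
      _ = 3 * π * (1 + 5 * |c'| * π) := by rw [this]
  have hκ0 : 0 ≤ κ := by rw [hκ]; positivity
  -- norms of the pieces
  have hU : ‖(((t / P1pp D : ℝ) : ℂ)) ^ beta6 D‖ = 1 := by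
    rw [Complex.norm_cpow_eq_rpow_re_of_pos (div_pos ht ha), hβ6re, Real.rpow_zero]
  have hU' : ‖beta6 D * (((t / P1pp D : ℝ) : ℂ)) ^ (beta6 D - 1) * ((1 / P1pp D : ℝ) : ℂ)‖ ≤ b / t := by
    rw [norm_mul, norm_mul, Complex.norm_cpow_eq_rpow_re_of_pos (div_pos ht ha), Complex.sub_re, hβ6re,
      Complex.one_re, zero_sub, Real.rpow_neg_one, Complex.norm_real, Real.norm_of_nonneg (by positivity)]
    have e : ‖beta6 D‖ * (t / P1pp D)⁻¹ * (1 / P1pp D) = ‖beta6 D‖ / t := by field_simp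
    rw [e]; exact div_le_div_of_nonneg_right hβ6 ht.le
  obtain ⟨hI1, hI2⟩ := norm_model_integrals_le hX0 hβ6re
  have hI1' : ‖∫ y in (1:ℝ)..X, (y : ℂ) ^ (beta6 D - 1)‖ ≤ Λ := hI1.trans hL2
  have hI2' : ‖∫ y in (1:ℝ)..X, (y : ℂ) ^ (beta6 D - 1) * (Real.log y : ℂ)‖ ≤ Λ ^ 2 :=
    hI2.trans (pow_le_pow_left₀ (abs_nonneg _) hL2 2)
  have hXβ : ‖(((X : ℝ) : ℂ)) ^ (beta6 D - 1)‖ = X⁻¹ := by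
    rw [Complex.norm_cpow_eq_rpow_re_of_pos hX0, Complex.sub_re, hβ6re, Complex.one_re, zero_sub,
      Real.rpow_neg_one]
  have hsm1 : ‖((-(P2pp D / t ^ 2) : ℝ) • ((((X : ℝ) : ℂ)) ^ (beta6 D - 1) * (Real.log X : ℂ)))‖ ≤ Λ / t := by
    rw [norm_smul, norm_mul, hXβ, Real.norm_eq_abs, abs_neg, abs_of_pos (by positivity), Complex.norm_real,
      Real.norm_eq_abs]
    have e : P2pp D / t ^ 2 * (X⁻¹ * |Real.log X|) = |Real.log X| / t := by
      rw [hX]; field_simp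
    rw [e]; exact div_le_div_of_nonneg_right hL2 ht.le
  have hsm2 : ‖((-(P2pp D / t ^ 2) : ℝ) • (((X : ℝ) : ℂ)) ^ (beta6 D - 1))‖ = 1 / t := by
    rw [norm_smul, hXβ, Real.norm_eq_abs, abs_neg, abs_of_pos (by positivity), hX]
    field_simp
  have hlogC : ‖(Real.log (t / P1pp D) : ℂ)‖ ≤ Λ := by rw [Complex.norm_real, Real.norm_eq_abs]; exact hL1
  have hinvt : ‖(((1 / t : ℝ) : ℂ))‖ = 1 / t := by
    rw [Complex.norm_real, Real.norm_of_nonneg (by positivity)]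
  have hγ : ‖betaJ c' D (j + 1) * betaJ c' D (j + 2)‖ ≤ b * b := by
    rw [norm_mul]; exact mul_le_mul hβ1 hβ2 (norm_nonneg _) hb0
  have hη : ‖-beta6 D + betaJ c' D (j + 1) + betaJ c' D (j + 2)‖ ≤ 3 * b := by
    refine (norm_add₃_le).trans ?_; rw [norm_neg]; linarith
  -- the four composite factors
  have hF1 : ‖(1 : ℂ) - betaJ c' D (j + 1) * betaJ c' D (j + 2) *
      ∫ y in (1:ℝ)..X, (y : ℂ) ^ (beta6 D - 1) * (Real.log y : ℂ)‖ ≤ 1 + κ ^ 2 := by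
    refine (norm_sub_le _ _).trans ?_
    rw [norm_one, norm_mul]
    have : ‖betaJ c' D (j + 1) * betaJ c' D (j + 2)‖ *
        ‖∫ y in (1:ℝ)..X, (y : ℂ) ^ (beta6 D - 1) * (Real.log y : ℂ)‖ ≤ (b * b) * Λ ^ 2 :=
      mul_le_mul hγ hI2' (norm_nonneg _) (by positivity)
    have e : (b * b) * Λ ^ 2 = κ ^ 2 := by rw [← hbΛ]; ring
    linarith
  have hF2 : ‖-(betaJ c' D (j + 1) * betaJ c' D (j + 2) *
      ((-(P2pp D / t ^ 2) : ℝ) • ((((X : ℝ) : ℂ)) ^ (beta6 D - 1) * (Real.log X : ℂ))))‖ ≤ b * κ / t := by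
    rw [norm_neg, norm_mul]
    calc ‖betaJ c' D (j + 1) * betaJ c' D (j + 2)‖ *
          ‖((-(P2pp D / t ^ 2) : ℝ) • ((((X : ℝ) : ℂ)) ^ (beta6 D - 1) * (Real.log X : ℂ)))‖
        ≤ (b * b) * (Λ / t) := mul_le_mul hγ hsm1 (norm_nonneg _) (by positivity)
      _ = b * κ / t := by rw [← hbΛ]; ring
  have hF3 : ‖-beta6 D + betaJ c' D (j + 1) + betaJ c' D (j + 2) +
      betaJ c' D (j + 1) * betaJ c' D (j + 2) * ∫ y in (1:ℝ)..X, (y : ℂ) ^ (beta6 D - 1)‖ ≤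
      3 * b + b * b * Λ := by
    have h4 : ‖betaJ c' D (j + 1) * betaJ c' D (j + 2) * ∫ y in (1:ℝ)..X, (y : ℂ) ^ (beta6 D - 1)‖ ≤
        b * b * Λ := by
      rw [norm_mul]; exact mul_le_mul hγ hI1' (norm_nonneg _) (by positivity)
    exact (norm_add_le _ _).trans (add_le_add hη h4)
  have hF4 : ‖betaJ c' D (j + 1) * betaJ c' D (j + 2) *
      ((-(P2pp D / t ^ 2) : ℝ) • (((X : ℝ) : ℂ)) ^ (beta6 D - 1))‖ ≤ b * b / t := by
    rw [norm_mul, hsm2]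
    calc ‖betaJ c' D (j + 1) * betaJ c' D (j + 2)‖ * (1 / t) ≤ (b * b) * (1 / t) :=
          mul_le_mul_of_nonneg_right hγ (by positivity)
      _ = b * b / t := by ring
  -- total
  have hbκ : b * b * Λ = b * κ := by rw [← hbΛ]; ring
  have htot : ‖-((beta6 D * (((t / P1pp D : ℝ) : ℂ)) ^ (beta6 D - 1) * ((1 / P1pp D : ℝ) : ℂ)) *
            (1 - betaJ c' D (j + 1) * betaJ c' D (j + 2) *
              ∫ y in (1:ℝ)..X, (y : ℂ) ^ (beta6 D - 1) * (Real.log y : ℂ)) +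
          (((t / P1pp D : ℝ) : ℂ)) ^ beta6 D *
            (-(betaJ c' D (j + 1) * betaJ c' D (j + 2) *
              ((-(P2pp D / t ^ 2) : ℝ) • ((((X : ℝ) : ℂ)) ^ (beta6 D - 1) * (Real.log X : ℂ))))) -
          ((beta6 D * (((t / P1pp D : ℝ) : ℂ)) ^ (beta6 D - 1) * ((1 / P1pp D : ℝ) : ℂ)) *
              (Real.log (t / P1pp D) : ℂ) *
              (-beta6 D + betaJ c' D (j + 1) + betaJ c' D (j + 2) +
                betaJ c' D (j + 1) * betaJ c' D (j + 2) * ∫ y in (1:ℝ)..X, (y : ℂ) ^ (beta6 D - 1)) +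
            (((t / P1pp D : ℝ) : ℂ)) ^ beta6 D * (((1 / t : ℝ) : ℂ)) *
              (-beta6 D + betaJ c' D (j + 1) + betaJ c' D (j + 2) +
                betaJ c' D (j + 1) * betaJ c' D (j + 2) * ∫ y in (1:ℝ)..X, (y : ℂ) ^ (beta6 D - 1)) +
            (((t / P1pp D : ℝ) : ℂ)) ^ beta6 D * (Real.log (t / P1pp D) : ℂ) *
              (betaJ c' D (j + 1) * betaJ c' D (j + 2) *
                ((-(P2pp D / t ^ 2) : ℝ) • (((X : ℝ) : ℂ)) ^ (beta6 D - 1)))))‖ ≤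
      (b / t * (1 + κ ^ 2) + b * κ / t) +
        (b / t * Λ * (3 * b + b * b * Λ) + 1 / t * (3 * b + b * b * Λ) + Λ * (b * b / t)) := by
    rw [norm_neg]
    refine (norm_sub_le _ _).trans (add_le_add ?_ ?_)
    · refine (norm_add_le _ _).trans (add_le_add ?_ ?_)
      · rw [norm_mul]; exact mul_le_mul hU' hF1 (norm_nonneg _) (by positivity)
      · rw [norm_mul, hU, one_mul]; exact hF2
    · refine (norm_add₃_le).trans (add_le_add (add_le_add ?_ ?_) ?_)
      · rw [norm_mul, norm_mul]
        exact mul_le_mul (mul_le_mul hU' hlogC (norm_nonneg _) (by positivity)) hF3 (norm_nonneg _)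
          (by positivity)
      · rw [norm_mul, norm_mul, hU, one_mul, hinvt]
        exact mul_le_mul_of_nonneg_left hF3 (by positivity)
      · rw [norm_mul, norm_mul, hU, one_mul]
        exact mul_le_mul hlogC hF4 (norm_nonneg _) (by positivity)
  refine htot.trans (le_of_eq ?_)
  have hb3 : b = 3 * (1 + 5 * |c'| * π) * alpha D := by rw [hbdef]; ring
  rw [hbκ]
  have e1 : b / t * Λ * (3 * b + b * κ) = b * (3 * κ + κ ^ 2) / t := by
    rw [show b / t * Λ * (3 * b + b * κ) = (b * Λ) * (3 * b + b * κ) / t by ring, hbΛ]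
    rw [show κ * (3 * b + b * κ) = b * (3 * κ + κ ^ 2) by ring]
  have e2 : 1 / t * (3 * b + b * κ) = b * (3 + κ) / t := by ring
  have e3 : Λ * (b * b / t) = b * κ / t := by
    rw [show Λ * (b * b / t) = b * (b * Λ) / t by ring, hbΛ]
  rw [e1, e2, e3, hb3]
  field_simp
  ring

end Calculus

end Top1225

end Literature.NumberTheory.LFunctions.Zhang2022.Typed.Sec12C
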